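import Literature.Probability.RandomPlanarGeometry.HullHausdorffCapacity
import Literature.Probability.RandomPlanarGeometry.HullApproximationProofs
import Literature.Probability.RandomPlanarGeometry.LoewnerSlitTheorem
import Literature.Probability.RandomPlanarGeometry.SlitLoewnerNested
import Literature.Probability.RandomPlanarGeometry.LoewnerHullCapacity
import HarnessLib

/-!
# The height of a hull is bounded by its capacity: `(im z)² ≤ 2 hcap(A)` for `z ∈ A`

Topic `Literature/Probability/RandomPlanarGeometry` (family `crit-ising`); theorems only, no
definition and no named fact.

A. Kemppainen, S. Smirnov, *Random curves, scaling limits and Loewner evolutions*, Ann. Probab.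
45 (2017), App. A, Lemma A.12 (arXiv:1212.6215, Lemma 5.12): "If `i ∈ K` then
`hcap(K) ≥ 1/4`" (sharp for the vertical slit; their `hcap` is half of Lawler's), with the
scaled form Lemma A.13: "If `K ∩ (ℝ × {hi}) ≠ ∅` then `hcap(K) ≥ h²/4`" — the estimate of the
proof of Prop. 3.7 ("if `K ∩ [-L + iu, L + iu] ≠ ∅` then `hcap(K) ≥ u²/4`") that turns a bound
on the driving process at a capacity time into an exit event of the curve. Printed proof:
approximate `K` from outside by a hull `K̃ ⊇ K` with smooth boundary and close capacity; `K̃`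
is swept by a Loewner chain, along which `∂_t (im g_t)² ≥ -4`, so no point of height `> 2√T`
is swallowed by capacity time `T`.

In Lawler's normalisation (`hcap K_t = 2t`, the tree's `hcap`) the statement reads
**`(im z)² ≤ 2 hcap(A)` for every point `z` of a bounded hull `A`**. This file PROVES it by the
printed route, every step of which is in the tree:

* the outer approximation by smooth `+`-hulls `J_n ↓`, `⋂ J_n = realFill A`
  (`IsPlusHull.exists_antitone_isArcHull_holds`, [LSW] Lemma 2.1, `HullApproximationProofs`);
* smooth hulls are terminal Loewner hulls (`IsArcHull.exists_loewner_chain_holds`, Loewner's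
  slit theorem, `LoewnerSlitTheorem.lean`) and `(im z)² ≤ 4t` on `K_t`
  (`Loewner.im_sq_le_of_mem_hull`, Lawler (2005), Thm. 4.6);
* the capacities `hcap J_n → hcap A` by the kernel theorem for Hausdorff-convergent hulls
  (`tendsto_hcap_of_thickening`, `HullHausdorffCapacity.lean`; decreasing compact sets converge
  to their intersection in the Hausdorff sense, `eventually_subset_thickening_iInter_of_antitone`);
* bookkeeping: `hcap` depends only on `ℍ ∖ K` and the values of the map there
  (`IsHydrodynamicMap.eqOn_of_diff_eq`, `IsHydrodynamicMap.hcap_eq_hcap_of_diff_eq`), real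
  translations (the general bounded hull is translated into a `+`-hull).

Results: `IsPlusHull.im_sq_le_two_mul_hcap`, **`IsBoundedHull.im_sq_le_two_mul_hcap`**,
`im_sq_le_two_mul_hcap_hpFill` (fills of closed bounded sets attached to the lower
half-plane, e.g. traces of curves from a real point), and `le_hcap_hpFill_image_Icc_of_le_im`
(the divergence hypothesis `hdiv` of `exists_capacity_parametrisation_of_limit`,
`LoewnerCurveLimit.lean`, from the unboundedness of `im η`).

## References

* A. Kemppainen, S. Smirnov, Ann. Probab. 45 (2017), App. A, Lemmas A.12–A.13 (arXiv
  Lemmas 5.12–5.13) and proof of Prop. 3.7. [KemppainenSmirnov2017]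
* G. F. Lawler, *Conformally Invariant Processes in the Plane*, AMS (2005), §3.4, §4.1 Thm. 4.6.
  [Lawler2005]
* G. F. Lawler, O. Schramm, W. Werner, J. Amer. Math. Soc. 16 (2003), Lemma 2.1.
  [LawlerSchrammWerner2003Restriction]
-/

noncomputable section

open Set Filter Topology Metric Bornology Complex Function
open UpperHalfPlane (upperHalfPlaneSet isOpen_upperHalfPlaneSet)
open scoped NNReal

namespace Literature.Probability.RandomPlanarGeometry

/-! ### `hcap` depends only on `ℍ ∖ K` -/

/-- **Uniqueness of the hydrodynamic map across presentations of the hull**: if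
`ℍ ∖ K = ℍ ∖ K'` and `φ, φ'` are hydrodynamically normalized conformal maps of these (equal)
domains onto `ℍ`, then `φ = φ'` there (Lawler (2005), Prop. 3.36, uniqueness).
[cite: Lawler2005, §3.4 Prop. 3.36] -/
theorem IsHydrodynamicMap.eqOn_of_diff_eq {K K' : Set ℂ}
    {φ : ConformalEquiv (upperHalfPlaneSet \ K) upperHalfPlaneSet}
    {φ' : ConformalEquiv (upperHalfPlaneSet \ K') upperHalfPlaneSet}
    (hφ : IsHydrodynamicMap K φ) (hφ' : IsHydrodynamicMap K' φ')
    (hKK' : upperHalfPlaneSet \ K = upperHalfPlaneSet \ K')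
    (hb : IsBounded (K ∩ upperHalfPlaneSet)) : EqOn φ φ' (upperHalfPlaneSet \ K) := by
  have hb' : IsBounded (K' ∩ upperHalfPlaneSet) := by
    have e : K' ∩ upperHalfPlaneSet = K ∩ upperHalfPlaneSet := by
      ext z
      constructor
      · rintro ⟨hzK, hzH⟩
        refine ⟨by_contra fun h ↦ ?_, hzH⟩
        have : z ∈ upperHalfPlaneSet \ K := ⟨hzH, h⟩
        rw [hKK'] at this
        exact this.2 hzK
      · rintro ⟨hzK, hzH⟩
        refine ⟨by_contra fun h ↦ ?_, hzH⟩
        have : z ∈ upperHalfPlaneSet \ K' := ⟨hzH, h⟩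
        rw [← hKK'] at this
        exact this.2 hzK
    rw [e]; exact hb
  -- `φ⁻¹ → ∞`, `φ'⁻¹ → ∞` within `ℍ ∖ K` as the argument tends to `∞` in `ℍ`
  have hs : Tendsto φ.symm (cocompact ℂ ⊓ 𝓟 upperHalfPlaneSet)
      (cocompact ℂ ⊓ 𝓟 (upperHalfPlaneSet \ K)) :=
    tendsto_inf.2 ⟨tendsto_cocompact_of_sub_self inf_le_left (hφ.tendsto_symm_sub_self hb),
      tendsto_principal.2 (by
        filter_upwards [mem_inf_of_right (mem_principal_self _)] with w hw using φ.symm_mapsTo hw)⟩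
  have hs' : Tendsto φ'.symm (cocompact ℂ ⊓ 𝓟 upperHalfPlaneSet)
      (cocompact ℂ ⊓ 𝓟 (upperHalfPlaneSet \ K)) := by
    rw [hKK']
    exact tendsto_inf.2 ⟨tendsto_cocompact_of_sub_self inf_le_left (hφ'.tendsto_symm_sub_self hb'),
      tendsto_principal.2 (by
        filter_upwards [mem_inf_of_right (mem_principal_self _)] with w hw using φ'.symm_mapsTo hw)⟩
  have hφ'' : Tendsto (fun z ↦ φ' z - z) (cocompact ℂ ⊓ 𝓟 (upperHalfPlaneSet \ K)) (𝓝 0) := by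
    rw [hKK']; exact hφ'
  -- the compositions are hydrodynamically normalized self-maps of `ℍ`
  have hlim₁ : Tendsto (fun w ↦ φ' (φ.symm w) - w) (cocompact ℂ ⊓ 𝓟 upperHalfPlaneSet) (𝓝 0) := by
    have ha := hφ''.comp hs
    have hsum := ha.add (hφ.tendsto_symm_sub_self hb)
    rw [add_zero] at hsum
    exact hsum.congr fun w ↦ by simp only [comp_apply]; ring
  have hlim₂ : Tendsto (fun w ↦ φ (φ'.symm w) - w) (cocompact ℂ ⊓ 𝓟 upperHalfPlaneSet) (𝓝 0) := by
    have ha := Tendsto.comp (show Tendsto _ _ _ from hφ) hs'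
    have hsum := ha.add (hφ'.tendsto_symm_sub_self hb')
    rw [add_zero] at hsum
    exact hsum.congr fun w ↦ by simp only [comp_apply]; ring
  have hsymm'K : ∀ w ∈ upperHalfPlaneSet, φ'.symm w ∈ upperHalfPlaneSet \ K := fun w hw ↦ by
    rw [hKK']; exact φ'.symm_mapsTo hw
  have hsymmK' : ∀ w ∈ upperHalfPlaneSet, φ.symm w ∈ upperHalfPlaneSet \ K' := fun w hw ↦ by
    rw [← hKK']; exact φ.symm_mapsTo hw
  have hd₁ : DifferentiableOn ℂ (fun w ↦ φ' (φ.symm w)) upperHalfPlaneSet :=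
    φ'.differentiableOn_coe.comp φ.symm.differentiableOn_coe fun w hw ↦ hsymmK' w hw
  have hd₂ : DifferentiableOn ℂ (fun w ↦ φ (φ'.symm w)) upperHalfPlaneSet :=
    φ.differentiableOn_coe.comp φ'.symm.differentiableOn_coe fun w hw ↦ hsymm'K w hw
  have hm₁ : MapsTo (fun w ↦ φ' (φ.symm w)) upperHalfPlaneSet upperHalfPlaneSet := fun w hw ↦
    φ'.mapsTo (hsymmK' w hw)
  have hm₂ : MapsTo (fun w ↦ φ (φ'.symm w)) upperHalfPlaneSet upperHalfPlaneSet := fun w hw ↦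
    φ.mapsTo (hsymm'K w hw)
  have hid := Complex.eqOn_id_of_tendsto_sub_self (g := fun w ↦ φ' (φ.symm w))
    (G := fun w ↦ φ (φ'.symm w)) hd₁ hm₁ hlim₁ hd₂ hm₂ hlim₂ (fun w hw ↦ by
      simp only
      rw [φ'.symm_apply_apply (hsymmK' w hw), φ.apply_symm_apply hw])
  intro z hz
  have h := hid (φ.mapsTo hz)
  simp only [id_eq] at h
  rw [φ.symm_apply_apply hz] at h
  exact h.symm

/-- **`hcap` depends only on `ℍ ∖ K`**: hydrodynamically normalized maps of hulls `K, K'` with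
`ℍ ∖ K = ℍ ∖ K'` have the same half-plane capacity (both maps agree there and `hcap` is the
limit of `z (φ(z) - z)` at `∞` within that set). [cite: Lawler2005, §3.4 Def. 3.37] -/
theorem IsHydrodynamicMap.hcap_eq_hcap_of_diff_eq {K K' : Set ℂ}
    {φ : ConformalEquiv (upperHalfPlaneSet \ K) upperHalfPlaneSet}
    {φ' : ConformalEquiv (upperHalfPlaneSet \ K') upperHalfPlaneSet}
    (hφ : IsHydrodynamicMap K φ) (hφ' : IsHydrodynamicMap K' φ')
    (hKK' : upperHalfPlaneSet \ K = upperHalfPlaneSet \ K')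
    (hb : IsBounded (K ∩ upperHalfPlaneSet)) : hcap K φ = hcap K' φ' := by
  have hb' : IsBounded (K' ∩ upperHalfPlaneSet) := by
    refine (hb.union (isBounded_empty (α := ℂ))).subset ?_
    rintro z ⟨hzK, hzH⟩
    left
    refine ⟨by_contra fun h ↦ ?_, hzH⟩
    have : z ∈ upperHalfPlaneSet \ K := ⟨hzH, h⟩
    rw [hKK'] at this
    exact this.2 hzK
  have heq := hφ.eqOn_of_diff_eq hφ' hKK' hb
  haveI := IsHydrodynamicMap.neBot_cocompact_inf hb
  have h1 := hφ.tendsto_mul_sub_self hb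
  have h2 := hφ'.tendsto_mul_sub_self hb'
  have h2' : Tendsto (fun z ↦ z * (φ' z - z)) (cocompact ℂ ⊓ 𝓟 (upperHalfPlaneSet \ K))
      (𝓝 (hcap K' φ' : ℂ)) := by
    rw [hKK']
    exact h2
  have h2'' : Tendsto (fun z ↦ z * (φ z - z)) (cocompact ℂ ⊓ 𝓟 (upperHalfPlaneSet \ K))
      (𝓝 (hcap K' φ' : ℂ)) := by
    refine h2'.congr' ?_
    filter_upwards [mem_inf_of_right (mem_principal_self _)] with z hz
    rw [heq hz]
  exact_mod_cast tendsto_nhds_unique h1 h2''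

/-! ### Decreasing compact sets converge to their intersection in the Hausdorff sense -/

/-- **Decreasing closed subsets of a compact set converge to their intersection**: for every
`ε > 0`, eventually `J_n ⊆ (⋂ J_m)^ε` (the other inclusion `⋂ J_m ⊆ J_n ⊆ (J_n)^ε` being
trivial). [folklore] -/
theorem eventually_subset_thickening_iInter_of_antitone {J : ℕ → Set ℂ} (hJc : IsCompact (J 0))
    (hcl : ∀ n, IsClosed (J n)) (hanti : Antitone J) {ε : ℝ} (hε : 0 < ε) :
    ∀ᶠ n in atTop, J n ⊆ thickening ε (⋂ m, J m) := by
  set L : Set ℂ := ⋂ m, J m with hL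
  set C : Set ℂ := J 0 \ thickening ε L with hC
  have hCc : IsCompact C := hJc.diff isOpen_thickening
  have hcover : C ⊆ ⋃ n, (J n)ᶜ := by
    intro x hx
    have hxL : x ∉ L := fun h ↦ hx.2 (self_subset_thickening hε L h)
    rw [hL, mem_iInter, not_forall] at hxL
    obtain ⟨n, hn⟩ := hxL
    exact mem_iUnion.2 ⟨n, hn⟩
  obtain ⟨t, ht⟩ := hCc.elim_finite_subcover (fun n ↦ (J n)ᶜ) (fun n ↦ (hcl n).isOpen_compl) hcover
  refine eventually_atTop.2 ⟨t.sup id, fun n hn x hx ↦ ?_⟩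
  by_contra hxt
  have hxC : x ∈ C := ⟨hanti (Nat.zero_le n) hx, hxt⟩
  obtain ⟨m, hm, hxm⟩ := mem_iUnion₂.1 (ht hxC)
  have hmn : m ≤ n := (Finset.le_sup (f := id) hm).trans hn
  exact hxm (hanti hmn hx)

/-! ### The complement of a bounded hull is its own unbounded component -/

/-- For a bounded hull `K` (`ℍ ∖ K` simply connected, hence connected, and containing a
neighbourhood of `∞` in `ℍ`), `ℍ ∖ K` is the unbounded component of itself. [folklore] -/
theorem IsBoundedHull.diff_eq_unboundedComponent {K : Set ℂ} (hK : IsBoundedHull K) :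
    upperHalfPlaneSet \ K = Loewner.unboundedComponent (upperHalfPlaneSet \ K) := by
  have hconn : IsPreconnected (upperHalfPlaneSet \ K) := hK.2.2.isPathConnected.isConnected.isPreconnected
  have hnb : ¬ IsBounded (upperHalfPlaneSet \ K) := by
    intro hbd
    obtain ⟨R, hR⟩ := (hbd.union hK.isCompact.isBounded).subset_closedBall 0
    set M : ℝ := |R| + 1 with hM
    have hz : ((M : ℂ) * Complex.I) ∈ upperHalfPlaneSet := by
      change 0 < ((M : ℂ) * Complex.I).im
      simp [hM]; positivity
    have hnorm : ‖(M : ℂ) * Complex.I‖ = M := by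
      rw [norm_mul, Complex.norm_real, norm_I, mul_one, Real.norm_eq_abs, abs_of_pos (by positivity)]
    rcases em (((M : ℂ) * Complex.I) ∈ K) with h | h
    · have := hR (Or.inr h)
      rw [mem_closedBall, dist_zero_right, hnorm, hM] at this
      linarith [le_abs_self R]
    · have := hR (Or.inl ⟨hz, h⟩)
      rw [mem_closedBall, dist_zero_right, hnorm, hM] at this
      linarith [le_abs_self R]
  refine Subset.antisymm (fun z hz ↦ ⟨hz, fun hb ↦ hnb ?_⟩) (Loewner.unboundedComponent_subset _)
  exact hb.subset (hconn.subset_connectedComponentIn hz Subset.rfl)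

/-- The real filling changes nothing in `ℍ`: `ℍ ∖ realFill A = ℍ ∖ A`. [folklore] -/
theorem diff_realFill_eq (A : Set ℂ) : upperHalfPlaneSet \ realFill A = upperHalfPlaneSet \ A := by
  ext z
  constructor
  · rintro ⟨hz, hzF⟩
    exact ⟨hz, fun h ↦ hzF (subset_realFill A h)⟩
  · rintro ⟨hz, hzA⟩
    exact ⟨hz, fun h ↦ hzA (realFill_inter_upperHalfPlaneSet_subset A ⟨h, hz⟩)⟩

/-! ### The height bound -/

/-- **`(im z)² ≤ 2 hcap(A)` for `z ∈ A`, `A` a nonempty `+`-hull** (Kemppainen–Smirnov's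
Lemma A.12 in Lawler's normalisation): outer approximation by smooth `+`-hulls `J_n ↓ A`
([LSW] Lemma 2.1), each the terminal hull of a Loewner chain (Loewner's slit theorem) on which
`(im z)² ≤ 4 T_n = 2 hcap J_n`, and `hcap J_n → hcap A` (kernel theorem).
[cite: KemppainenSmirnov2017, App. A Lemma A.12] [cite: Lawler2005, Ch. 4 §4.1 Thm. 4.6] -/
theorem IsPlusHull.im_sq_le_two_mul_hcap {A : Set ℂ} (hA : IsPlusHull A) {z : ℂ} (hz : z ∈ A)
    (hzi : 0 < z.im) {φ : ConformalEquiv (upperHalfPlaneSet \ A) upperHalfPlaneSet}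
    (hφ : IsHydrodynamicMap A φ) : z.im ^ 2 ≤ 2 * hcap A φ := by
  have hne : A.Nonempty := ⟨z, hz⟩
  obtain ⟨J, hJarc, hJplus, hanti, hInter, -⟩ := IsPlusHull.exists_antitone_isArcHull_holds hA hne
  have hAJ : ∀ n, A ⊆ J n := fun n ↦
    (subset_realFill A).trans (hInter ▸ iInter_subset J n)
  -- each `J_n` is the terminal hull of a Loewner chain: `(im z)² ≤ 4 T_n`
  have hchain : ∀ n, ∃ (W : ℝ≥0 → ℝ) (T : ℝ≥0), Continuous W ∧
      Loewner.hull W T = J n ∩ upperHalfPlaneSet := by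
    intro n
    obtain ⟨-, γ, hγc, hγi, hγ0, hγ1, hγpos, hfr⟩ := hJarc n
    obtain ⟨W, T, -, hWc, -, -, -, -, -, -, -, hT⟩ :=
      IsArcHull.exists_loewner_chain_holds (hJarc n) (hJplus n) hγc hγi hγ0 hγ1 hγpos hfr
    exact ⟨W, T, hWc, hT⟩
  choose W T hWc hT using hchain
  have hheight : ∀ n, z.im ^ 2 ≤ 4 * (T n : ℝ) := fun n ↦
    Loewner.im_sq_le_of_mem_hull (hWc n) (by rw [hT n]; exact ⟨hAJ n hz, hzi⟩)
  -- hydrodynamic maps of the `J_n` and their capacity `2 T_n`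
  have hmaps : ∀ n, ∃ ψ : ConformalEquiv (upperHalfPlaneSet \ J n) upperHalfPlaneSet,
      IsHydrodynamicMap (J n) ψ ∧ hcap (J n) ψ = 2 * (T n : ℝ) := by
    intro n
    obtain ⟨ψ, hψ⟩ := IsStarHull.exists_isHydrodynamicMap (hJplus n).1
    obtain ⟨φL, hφL⟩ := Loewner.exists_conformalEquiv_map_holds (hWc n) (T n)
    have hL := Loewner.isHydrodynamicMap_of_eqOn (hWc n) (T n) hφL
    have hcapL := Loewner.hcap_hull_eq (hWc n) (T n) hφL
    have hdiff : upperHalfPlaneSet \ J n = upperHalfPlaneSet \ Loewner.hull (W n) (T n) := by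
      rw [hT n]
      ext w
      simp only [Set.mem_sdiff, mem_inter_iff, not_and]
      constructor
      · rintro ⟨hw, hwJ⟩
        exact ⟨hw, fun h _ ↦ hwJ h⟩
      · rintro ⟨hw, h⟩
        exact ⟨hw, fun hwJ ↦ h hwJ hw⟩
    refine ⟨ψ, hψ, ?_⟩
    rw [hψ.hcap_eq_hcap_of_diff_eq hL hdiff
      ((hJplus n).1.isBoundedHull.isCompact.isBounded.subset inter_subset_left), hcapL]
  choose ψ hψ hcapψ using hmaps
  -- a common bound
  obtain ⟨R₀, hR₀⟩ := (hJplus 0).1.isBoundedHull.isCompact.isBounded.subset_closedBall 0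
  set R : ℝ := |R₀| + 1 with hR
  have hR0 : 0 < R := by positivity
  have hJR : ∀ n, J n ⊆ closedBall (0 : ℂ) R := fun n ↦
    (hanti (Nat.zero_le n)).trans (hR₀.trans (closedBall_subset_closedBall (by
      rw [hR]; linarith [le_abs_self R₀])))
  have hFR : realFill A ⊆ closedBall (0 : ℂ) R := (hInter ▸ iInter_subset J 0).trans (hJR 0)
  -- the kernel theorem: `hcap J_n → hcap A`
  have hV : upperHalfPlaneSet \ A = Loewner.unboundedComponent (upperHalfPlaneSet \ realFill A) := by
    rw [diff_realFill_eq]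
    exact hA.1.isBoundedHull.diff_eq_unboundedComponent
  have hVn : ∀ n, upperHalfPlaneSet \ J n = Loewner.unboundedComponent (upperHalfPlaneSet \ J n) :=
    fun n ↦ (hJplus n).1.isBoundedHull.diff_eq_unboundedComponent
  have h1 : ∀ ε > 0, ∀ᶠ n in atTop, J n ⊆ thickening ε (realFill A) := fun ε hε ↦ by
    rw [← hInter]
    exact eventually_subset_thickening_iInter_of_antitone (hJplus 0).1.isBoundedHull.isCompact
      (fun n ↦ (hJplus n).1.isBoundedHull.isClosed) hanti hε
  have h2 : ∀ ε > 0, ∀ᶠ n in atTop, realFill A ⊆ thickening ε (J n) := fun ε hε ↦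
    Eventually.of_forall fun n ↦ (hInter ▸ iInter_subset J n).trans (self_subset_thickening hε _)
  have hconv := tendsto_hcap_of_thickening (Sn := J) (S := realFill A) (Kn := J) (K := A)
    (φn := ψ) (φ := φ) hR0 hFR hJR hV hVn hφ hψ h1 h2
  -- conclusion
  have hconv' : Tendsto (fun n ↦ 2 * (2 * (T n : ℝ))) atTop (𝓝 (2 * hcap A φ)) := by
    have := hconv.const_mul 2
    refine this.congr fun n ↦ ?_
    rw [hcapψ n]
  exact ge_of_tendsto hconv' (Eventually.of_forall fun n ↦ by linarith [hheight n])

/-- **`(im z)² ≤ 2 hcap(K)` for every point `z` of a bounded hull `K`** (`K ∈ 𝒬`: bounded, the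
closure of its part in `ℍ`, simply connected complement) — Kemppainen–Smirnov's Lemma A.12 /
A.13 in Lawler's normalisation (`hcap` of the vertical slit `[x, x + ih]` is `h²/2`): a real
translate of `K` is a `+`-hull with the same height and capacity.
[cite: KemppainenSmirnov2017, App. A Lemmas A.12–A.13] [cite: Lawler2005, Ch. 4 §4.1 Thm. 4.6] -/
theorem IsBoundedHull.im_sq_le_two_mul_hcap {K : Set ℂ} (hK : IsBoundedHull K) {z : ℂ}
    (hz : z ∈ K) (hzi : 0 < z.im) {φ : ConformalEquiv (upperHalfPlaneSet \ K) upperHalfPlaneSet}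
    (hφ : IsHydrodynamicMap K φ) : z.im ^ 2 ≤ 2 * hcap K φ := by
  -- translate `K` into a `+`-hull
  obtain ⟨R₀, hR₀⟩ := hK.isCompact.isBounded.subset_closedBall 0
  set c : ℝ := |R₀| + 1 with hc
  have hc0 : 0 < c := by positivity
  set K' : Set ℂ := (fun w : ℂ ↦ w + (c : ℂ)) '' K with hK'def
  have hK' : IsBoundedHull K' := hK.image_add_real c
  have hreal : ∀ x : ℝ, (x : ℂ) ∈ K' → 0 < x := by
    rintro x ⟨w, hw, hwx⟩
    have h1 : ‖w‖ ≤ R₀ := by simpa using hR₀ hw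
    have h2 : w = (x : ℂ) - c := eq_sub_of_add_eq hwx
    rw [h2, ← ofReal_sub, Complex.norm_real, Real.norm_eq_abs] at h1
    have := neg_abs_le (x - c)
    linarith [le_abs_self R₀]
  have h0 : (0 : ℂ) ∉ K' := fun h ↦ by
    have := hreal 0 (by simpa using h)
    exact lt_irrefl _ this
  have hplus : IsPlusHull K' := ⟨⟨hK', h0⟩, hreal⟩
  -- the translated map `φ' w = φ (w - c) + c`
  have hmem : ∀ {w : ℂ}, w ∈ upperHalfPlaneSet \ K' ↔ w - (c : ℂ) ∈ upperHalfPlaneSet \ K := by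
    intro w
    simp only [Set.mem_sdiff, hK'def, mem_image]
    have him : (w - (c : ℂ)).im = w.im := by simp
    change 0 < w.im ∧ _ ↔ 0 < (w - (c : ℂ)).im ∧ _
    rw [him]
    refine and_congr Iff.rfl ⟨fun hw hwK ↦ hw ⟨w - c, hwK, sub_add_cancel w c⟩, ?_⟩
    rintro hw ⟨y, hy, hyw⟩
    apply hw
    rwa [← hyw, add_sub_cancel_right]
  have hTbij : BijOn (fun w : ℂ ↦ w - (c : ℂ)) (upperHalfPlaneSet \ K') (upperHalfPlaneSet \ K) := by
    refine ⟨fun w hw ↦ hmem.1 hw, fun w _ w' _ h ↦ sub_left_injective h, fun u hu ↦ ?_⟩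
    refine ⟨u + c, hmem.2 ?_, add_sub_cancel_right u c⟩
    rwa [add_sub_cancel_right]
  have hTd : DifferentiableOn ℂ (fun w : ℂ ↦ w - (c : ℂ)) (upperHalfPlaneSet \ K') :=
    differentiableOn_id.sub_const _
  have hTinv : DifferentiableOn ℂ (invFunOn (fun w : ℂ ↦ w - (c : ℂ)) (upperHalfPlaneSet \ K'))
      (upperHalfPlaneSet \ K) := by
    refine (differentiableOn_id.add_const (c : ℂ)).congr fun u hu ↦ ?_
    have h := hTbij.invOn_invFunOn.2 hu
    simp only at h
    simp only [id_eq]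
    exact eq_add_of_sub_eq h
  set T : ConformalEquiv (upperHalfPlaneSet \ K') (upperHalfPlaneSet \ K) :=
    ConformalEquiv.ofBijOn _ hTd hTbij hTinv with hTdef
  set φ' : ConformalEquiv (upperHalfPlaneSet \ K') upperHalfPlaneSet :=
    T.trans (φ.trans (addRealUpperHalfPlane c)) with hφ'def
  have hφ'_apply : ∀ w, φ' w = φ (w - c) + c := fun w ↦ by
    simp [hφ'def, hTdef, ConformalEquiv.trans_apply, ConformalEquiv.ofBijOn_apply,
      addRealUpperHalfPlane_apply]
  have hT_tend : Tendsto (fun w : ℂ ↦ w - (c : ℂ)) (cocompact ℂ ⊓ 𝓟 (upperHalfPlaneSet \ K'))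
      (cocompact ℂ ⊓ 𝓟 (upperHalfPlaneSet \ K)) := by
    refine tendsto_inf.2 ⟨tendsto_cocompact_of_norm_sub_self_le (C := ‖(c : ℂ)‖) inf_le_left
      (Eventually.of_forall fun w ↦ by rw [sub_sub_cancel_left, norm_neg]), tendsto_principal.2 ?_⟩
    filter_upwards [mem_inf_of_right (mem_principal_self _)] with w hw using hTbij.mapsTo hw
  have hφ' : IsHydrodynamicMap K' φ' := by
    change Tendsto (fun w ↦ φ' w - w) (cocompact ℂ ⊓ 𝓟 (upperHalfPlaneSet \ K')) (𝓝 0)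
    have h1 := Tendsto.comp (show Tendsto _ _ _ from hφ) hT_tend
    refine h1.congr' (Eventually.of_forall fun w ↦ ?_)
    simp only [comp_apply, hφ'_apply]
    ring
  -- the capacities agree
  have hb : IsBounded (K ∩ upperHalfPlaneSet) := hK.isCompact.isBounded.subset inter_subset_left
  have hb' : IsBounded (K' ∩ upperHalfPlaneSet) := hK'.isCompact.isBounded.subset inter_subset_left
  haveI := IsHydrodynamicMap.neBot_cocompact_inf hb'
  have hcap_eq : hcap K' φ' = hcap K φ := by
    have h1 := hφ'.tendsto_mul_sub_self hb'
    -- `w (φ'(w) - w) = (w - c)(φ(w - c) - (w - c)) + c (φ(w - c) - (w - c))`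
    have h2 : Tendsto (fun w ↦ (w - c) * (φ (w - c) - (w - c)) + c * (φ (w - c) - (w - c)))
        (cocompact ℂ ⊓ 𝓟 (upperHalfPlaneSet \ K')) (𝓝 ((hcap K φ : ℂ) + c * 0)) :=
      ((hφ.tendsto_mul_sub_self hb).comp hT_tend).add
        ((Tendsto.comp (show Tendsto _ _ _ from hφ) hT_tend).const_mul (c : ℂ))
    rw [mul_zero, add_zero] at h2
    have h3 : Tendsto (fun w ↦ w * (φ' w - w)) (cocompact ℂ ⊓ 𝓟 (upperHalfPlaneSet \ K'))
        (𝓝 (hcap K φ : ℂ)) := by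
      refine h2.congr fun w ↦ ?_
      rw [hφ'_apply]
      ring
    exact_mod_cast tendsto_nhds_unique h1 h3
  -- apply the `+`-hull bound at `z + c`
  have hz' : z + (c : ℂ) ∈ K' := ⟨z, hz, rfl⟩
  have hzi' : 0 < (z + (c : ℂ)).im := by simpa using hzi
  have h := hplus.im_sq_le_two_mul_hcap hz' hzi' hφ'
  rw [hcap_eq] at h
  simpa using h

/-- **`(im z)² ≤ 2 hcap(Fill S)` for `z ∈ S`**, `S` closed, bounded and attached to the lower
half-plane (`S ∪ {im ≤ 0}` connected; e.g. the trace of a curve in `ℍ̄` from a real point):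
Kemppainen–Smirnov's "if `K ∩ (ℝ × {hi}) ≠ ∅` then `hcap(K) ≥ h²/4`" for the hulls generated by
such sets. [cite: KemppainenSmirnov2017, App. A Lemma A.13] -/
theorem im_sq_le_two_mul_hcap_hpFill {S : Set ℂ} (hS : IsClosed S) (hSb : IsBounded S)
    (hconn : IsConnected (S ∪ {z : ℂ | z.im ≤ 0})) {z : ℂ} (hz : z ∈ S) (hzi : 0 < z.im)
    {φ : ConformalEquiv (upperHalfPlaneSet \ hpFill S) upperHalfPlaneSet}
    (hφ : IsHydrodynamicMap (hpFill S) φ) : z.im ^ 2 ≤ 2 * hcap (hpFill S) φ :=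
  (isBoundedHull_hpFill isSimplyConnected_of_isConnected_compl_holds hS hSb hconn).im_sq_le_two_mul_hcap
    (inter_subset_hpFill S ⟨hz, hzi⟩) hzi hφ

/-- **The capacity of the initial segments of a curve dominates the square of its height**:
for `η` continuous on `[0, 1)` with `im η 0 = 0` and a parameter `s` with `0 < im η(s)`, every
hydrodynamic map of `Fill η[0, s]` has `(im η s)² ≤ 2 hcap`. Hence the divergence hypothesis
`hdiv` of `exists_capacity_parametrisation_of_limit` (`LoewnerCurveLimit.lean`) holds as soon
as `im η` is unbounded on `[0, 1)` (`le_hcap_hpFill_image_Icc_of_le_im`).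
[cite: KemppainenSmirnov2017, App. A Lemma A.13] -/
theorem im_sq_le_two_mul_hcap_hpFill_image_Icc {η : ℝ → ℂ} (hc : ContinuousOn η (Ico 0 1))
    (h0 : (η 0).im = 0) {s : ℝ} (hs : s ∈ Ico (0 : ℝ) 1) (hsi : 0 < (η s).im)
    {φ : ConformalEquiv (upperHalfPlaneSet \ hpFill (η '' Icc 0 s)) upperHalfPlaneSet}
    (hφ : IsHydrodynamicMap (hpFill (η '' Icc 0 s)) φ) :
    (η s).im ^ 2 ≤ 2 * hcap (hpFill (η '' Icc 0 s)) φ := by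
  have hIcc_sub : Icc (0 : ℝ) s ⊆ Ico 0 1 := fun u hu ↦ ⟨hu.1, hu.2.trans_lt hs.2⟩
  have hSc : IsCompact (η '' Icc 0 s) := isCompact_Icc.image_of_continuousOn (hc.mono hIcc_sub)
  have hconn : IsConnected (η '' Icc 0 s ∪ {z : ℂ | z.im ≤ 0}) := by
    have h1 : IsConnected (η '' Icc 0 s) := (isConnected_Icc hs.1).image _ (hc.mono hIcc_sub)
    have h2 : IsConnected {z : ℂ | z.im ≤ 0} := (convex_halfSpace_im_le 0).isConnected ⟨0, by simp⟩
    exact IsConnected.union ⟨η 0, ⟨0, ⟨le_rfl, hs.1⟩, rfl⟩, by simp [h0]⟩ h1 h2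
  exact im_sq_le_two_mul_hcap_hpFill hSc.isClosed hSc.isBounded hconn ⟨s, ⟨hs.1, le_rfl⟩, rfl⟩ hsi hφ

/-- **Divergence of the capacity from unboundedness of the height**: under the hypotheses of
`im_sq_le_two_mul_hcap_hpFill_image_Icc`, if `im η` is unbounded on `[0, 1)` then for every
`M` some initial segment `η[0, s]` has capacity `≥ M` — the hypothesis `hdiv` of
`exists_capacity_parametrisation_of_limit`. [cite: KemppainenSmirnov2017, App. A Lemma A.13] -/
theorem le_hcap_hpFill_image_Icc_of_le_im {η : ℝ → ℂ} (hc : ContinuousOn η (Ico 0 1))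
    (h0 : (η 0).im = 0) (hdivIm : ∀ M : ℝ, ∃ s ∈ Ico (0 : ℝ) 1, M ≤ (η s).im) (M : ℝ) :
    ∃ s ∈ Ico (0 : ℝ) 1,
      ∀ φ : ConformalEquiv (upperHalfPlaneSet \ hpFill (η '' Icc 0 s)) upperHalfPlaneSet,
        IsHydrodynamicMap (hpFill (η '' Icc 0 s)) φ → M ≤ hcap (hpFill (η '' Icc 0 s)) φ := by
  obtain ⟨s, hs, hM⟩ := hdivIm (Real.sqrt (2 * max M 0) + 1)
  refine ⟨s, hs, fun φ hφ ↦ ?_⟩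
  have hsi : 0 < (η s).im := lt_of_lt_of_le (by positivity) hM
  have h1 := im_sq_le_two_mul_hcap_hpFill_image_Icc hc h0 hs hsi hφ
  have h2 : 2 * max M 0 ≤ (η s).im ^ 2 := by
    have h3 : 0 ≤ Real.sqrt (2 * max M 0) := Real.sqrt_nonneg _
    have h4 : Real.sqrt (2 * max M 0) ^ 2 = 2 * max M 0 := Real.sq_sqrt (by positivity)
    nlinarith [hM, h3, h4]
  linarith [le_max_left M 0]

end Literature.Probability.RandomPlanarGeometry
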